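import Mathlib
import HarnessLib
import Summits.HubbardSuperconductivity.HubbardSuperconductivity.Theorems.KLProgrammeKLRegimeTwoVolumeLipDoubledTruncDefs
import Summits.HubbardSuperconductivity.HubbardSuperconductivity.Theorems.KLProgrammeKLRegimeTwoVolumeLipDoubledReadout
import Summits.HubbardSuperconductivity.HubbardSuperconductivity.Theorems.KLProgrammeKLRegimeTwoVolumeDualRowsFrameSplit
import Summits.HubbardSuperconductivity.HubbardSuperconductivity.Theorems.KLProgrammeKLRegimeTwoVolumeTorusBlocks
import Summits.HubbardSuperconductivity.HubbardSuperconductivity.Theorems.KLProgrammeKLRegimeEngineTowerBlockIncrWtKitCarrier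

/-!
# Route `KLProgramme` — crux K3 ENGINE (stmt-HubbardSuperconductivity-20437 `KLRegimeEngineV17F2`), stub (e) proof-input «(e)-D-ROWS», keying (A′), REKEY-D file D11T:
# THE READ-OUT OF THE SOURCE-TRUNCATED DOUBLED TOWER INTO F-D1's COMMON-FRAME PINNED DEFECT `hPc`
# (seat hubbard-kl-k3c4-p1 g28; consumer ✓ `TwoVolumeDefect.hPd_of_commonFrame_add_conversion` / `hdualSp_point_of_commonFrame_add_conversion` (g26); `--supports` 23356)

F-D1's `hPc σ` reads, at a coarse pin `oc` and a fine pin `of`, the sum over times `t₁` and coarse offsets `ȳ` of the difference of the RAW two-leg kernels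
(`sectorisedKernel … (trivialMultiplier …) (T^{V}(K) − 𝒩^{V}_K) 2 Ω_σ`) of the coarse volume at `(oc, (t₁, oc.2 ± ȳ))` and of the fine volume at `(of, (t₁, of.2 ± ι ȳ))`, `ι` the centred lift.
Choosing `of` `R`-deep in its coarse block and `oc := res of`, the all-plain degree-2 strings of the truncated doubled input difference `klLipInputDiffDT … d k` through the plain pin at `of`
(copy 1, slot 0, charge 0) ARE `ε²·(W^{bL} − [same block]·W^{L})` at exactly these arguments (✓ D11a `kernel_klLipInputDiffD_src`; `srcCount = 2 < 3`), the strings leaving the block are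
FAR (`R < tnorm`, ✓ `tnorm_sub_gt_of_block_ne`), and the counterterm part is carried as a named seam:

* **`plainTwoLegDefect_le`** — for one orientation (coarse second site `sc ȳ`, fine second site `sf ȳ` with `res (sf ȳ) = sc ȳ`, `sf` injective):
  `Σ_{t₁,ȳ} ‖W^{L}(T−𝒩)(oc; t₁, sc ȳ) − W^{bL}(T−𝒩)(of; t₁, sf ȳ)‖ ≤ ε⁻²·klLipInputDiffSupDT … d k 2 R + Far + Seam`, where `Far` bounds the coarse + fine raw rows over the offsets with
  `R < tnorm (sf ȳ − of.2)` and `Seam` the counterterm two-volume seam `Σ ‖W^{L}(𝒩_K)(oc;·) − W^{bL}(𝒩_K)(of;·)‖` (zero at deep pins for `deg K < R`; not discharged here);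
* **`hPc_of_truncReadout`** — both orientations of `hPd_of_commonFrame_add_conversion`'s `hPc σ` (`sc = oc.2 ± ·`, `sf = of.2 ± ι ·`): `≤ 2ε⁻²·klLipInputDiffSupDT … 2 R + Far₊ + Far₋ + Seam₊ + Seam₋`.

So the (A′) read-out of hVL's common-frame defect at scale `n′ = dk` is the truncated-doubled tower's degree-2 INPUT-difference sup of block `k` (the assembly's second conclusion) plus E1 (b)-class far rows
plus the seam.  Bookkeeping on landed identities; nothing asserts the (D) rows, hVL, (e), VL, K3 or superconductivity.  NOTE for the closer: the fine volume is typed `b * L`.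
References: BGM 2006 §2.9 (4.3)–(4.8), §3 (3.2)–(3.8) [cite: BenfattoGiulianiMastropietro2006].
-/

noncomputable section

namespace Summit.HubbardSuperconductivity.HubbardSuperconductivity.Theorems.TwoVolumeLip

set_option linter.dupNamespace false -- summit = problem name (single-conjunct summit), D-0017

open Finset Literature.MathematicalPhysics.QuantumLattice GrassmannAlgebra Literature.Probability.LatticeModels
open Literature.MathematicalPhysics.QuantumLattice.FermiRG
open Summit.HubbardSuperconductivity.HubbardSuperconductivity.Theorems.KLRegimeSplit
open Summit.HubbardSuperconductivity.HubbardSuperconductivity.Theorems.KLProgrammeLegKernels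
open Summit.HubbardSuperconductivity.HubbardSuperconductivity.Theorems.EngineV8
open Summit.HubbardSuperconductivity.HubbardSuperconductivity.Theorems.TwoVolumeSource
open Summit.HubbardSuperconductivity.HubbardSuperconductivity.Theorems.TwoVolumeDefect

section ReadoutDT

variable {L b M : ℕ} [NeZero L] [NeZero (b * L)] [NeZero M]

omit [NeZero M] in
/-- The residue of a sum with a centred lift: `res (x + ι ȳ) = res x + ȳ`, `res (x − ι ȳ) = res x − ȳ` (`ι = Torus.proj (bL) ∘ Torus.cRep`). -/
theorem res_add_lift (x : TorusSite 2 (b * L)) (ybar : TorusSite 2 L) (i : Fin 2) :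
    ((((x + Torus.proj (b * L) (Torus.cRep ybar)) i).val : ℕ) : ZMod L) = (((x i).val : ℕ) : ZMod L) + ybar i ∧
      ((((x + -Torus.proj (b * L) (Torus.cRep ybar)) i).val : ℕ) : ZMod L) = (((x i).val : ℕ) : ZMod L) - ybar i := by
  have hdvd : L ∣ b * L := dvd_mul_left L b
  have hcast : ∀ z : ZMod (b * L), (((z.val : ℕ)) : ZMod L) = ZMod.castHom hdvd (ZMod L) z := fun z => by
    rw [ZMod.castHom_apply, ZMod.cast_eq_val]
  have hlift : ZMod.castHom hdvd (ZMod L) (Torus.proj (b * L) (Torus.cRep ybar) i) = ybar i := by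
    rw [Torus.proj_apply, map_intCast, Torus.cRep, Torus.intCast_cRepZ]
  refine ⟨?_, ?_⟩
  · rw [hcast, hcast, Pi.add_apply, map_add, hlift]
  · rw [hcast, hcast, Pi.add_apply, Pi.neg_apply, map_add, map_neg, hlift, sub_eq_add_neg]

/-- **ONE ORIENTATION OF THE READ-OUT** (see the module docstring): `of` `R`-deep, `oc := res of`, second sites `sc ȳ` (coarse) / `sf ȳ` (fine) with `res (sf ȳ) = sc ȳ` and `sf` injective;
`Far` bounds the coarse + fine raw two-leg rows over the offsets leaving the block (`R < tnorm (sf ȳ − of.2)`), `Seam` the counterterm seam.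
[cite: BenfattoGiulianiMastropietro2006, §2.9 (4.3)-(4.6)] -/
theorem plainTwoLegDefect_le {β : ℝ} (hβ : 0 < β) (U μ : ℝ) (K : TrigPolyC4v) (d k R : ℕ) (σ : Fin 2)
    (of : SpaceTimeIdx (b * L) M) (hof : ∀ j, R ≤ (of.2 j).val % L ∧ (of.2 j).val % L + R < L)
    (sc : TorusSite 2 L → TorusSite 2 L) (sf : TorusSite 2 L → TorusSite 2 (b * L)) (hsf : Function.Injective sf)
    (hres : ∀ ybar i, ((((sf ybar) i).val : ℕ) : ZMod L) = sc ybar i) {Far Seam : ℝ}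
    (hFar : ∑ t₁ : ImagTimeIdx M, ∑ ybar ∈ univ.filter (fun ybar : TorusSite 2 L => R < Torus.tnorm (sf ybar - of.2)),
        (‖sectorisedKernel L M β (trivialMultiplier L M) (klTowerInput L M β U μ K d k) 2
              (![((0, σ), 0), ((0, σ), 1)] : Fin 2 → SectorLeg 1) ![(of.1, fun i => (((of.2 i).val : ℕ) : ZMod L)), (t₁, sc ybar)]‖ +
          ‖sectorisedKernel (b * L) M β (trivialMultiplier (b * L) M) (klTowerInput (b * L) M β U μ K d k) 2
              (![((0, σ), 0), ((0, σ), 1)] : Fin 2 → SectorLeg 1) ![of, (t₁, sf ybar)]‖) ≤ Far)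
    (hSeam : ∑ t₁ : ImagTimeIdx M, ∑ ybar : TorusSite 2 L,
        ‖sectorisedKernel L M β (trivialMultiplier L M) (counterQuadratic L M β K) 2
              (![((0, σ), 0), ((0, σ), 1)] : Fin 2 → SectorLeg 1) ![(of.1, fun i => (((of.2 i).val : ℕ) : ZMod L)), (t₁, sc ybar)] -
            sectorisedKernel (b * L) M β (trivialMultiplier (b * L) M) (counterQuadratic (b * L) M β K) 2
              (![((0, σ), 0), ((0, σ), 1)] : Fin 2 → SectorLeg 1) ![of, (t₁, sf ybar)]‖ ≤ Seam) :
    ∑ t₁ : ImagTimeIdx M, ∑ ybar : TorusSite 2 L,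
        ‖sectorisedKernel L M β (trivialMultiplier L M) (klTowerInput L M β U μ K d k - counterQuadratic L M β K) 2
              (![((0, σ), 0), ((0, σ), 1)] : Fin 2 → SectorLeg 1) ![(of.1, fun i => (((of.2 i).val : ℕ) : ZMod L)), (t₁, sc ybar)] -
            sectorisedKernel (b * L) M β (trivialMultiplier (b * L) M) (klTowerInput (b * L) M β U μ K d k - counterQuadratic (b * L) M β K) 2
              (![((0, σ), 0), ((0, σ), 1)] : Fin 2 → SectorLeg 1) ![of, (t₁, sf ybar)]‖ ≤
      (imagTimeWeight β M ^ 2)⁻¹ * klLipInputDiffSupDT L b M β U μ K d k 2 R + Far + Seam := by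
  classical
  have hx : 0 < imagTimeWeight β M := imagTimeWeight_pos_of_pos (M := M) hβ
  have hx2 : 0 < imagTimeWeight β M ^ 2 := pow_pos hx 2
  -- abbreviations
  set Ω : Fin 2 → SectorLeg 1 := ![((0, σ), 0), ((0, σ), 1)] with hΩ
  set oc : SpaceTimeIdx L M := (of.1, fun i => (((of.2 i).val : ℕ) : ZMod L)) with hoc
  set WC : ImagTimeIdx M → TorusSite 2 L → ℂ := fun t₁ ybar =>
    sectorisedKernel L M β (trivialMultiplier L M) (klTowerInput L M β U μ K d k) 2 Ω ![oc, (t₁, sc ybar)] with hWC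
  set WF : ImagTimeIdx M → TorusSite 2 L → ℂ := fun t₁ ybar =>
    sectorisedKernel (b * L) M β (trivialMultiplier (b * L) M) (klTowerInput (b * L) M β U μ K d k) 2 Ω ![of, (t₁, sf ybar)] with hWF
  set NC : ImagTimeIdx M → TorusSite 2 L → ℂ := fun t₁ ybar =>
    sectorisedKernel L M β (trivialMultiplier L M) (counterQuadratic L M β K) 2 Ω ![oc, (t₁, sc ybar)] with hNC
  set NF : ImagTimeIdx M → TorusSite 2 L → ℂ := fun t₁ ybar =>
    sectorisedKernel (b * L) M β (trivialMultiplier (b * L) M) (counterQuadratic (b * L) M β K) 2 Ω ![of, (t₁, sf ybar)] with hNF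
  -- the plain doubled strings through the pin `w` at `of`
  set s0 : Fin (sectorCount (d * k - 1)) := ⟨0, sectorCount_pos _⟩ with hs0
  set w : SrcLabel (b * L) M (d * k - 1) := ((of, ((s0, σ), 0)), 1) with hw
  set X : ImagTimeIdx M → TorusSite 2 L → Fin 2 → SrcLabel (b * L) M (d * k - 1) := fun t₁ ybar =>
    ![w, (((t₁, sf ybar), ((s0, σ), 1)), 1)] with hX
  have hX0 : ∀ t₁ ybar, X t₁ ybar 0 = w := fun _ _ => rfl
  have hX1 : ∀ t₁ ybar, X t₁ ybar 1 = (((t₁, sf ybar), ((s0, σ), 1)), 1) := fun _ _ => rfl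
  have hXcopy : ∀ t₁ ybar i, (X t₁ ybar i).2 = 1 := fun t₁ ybar i => by fin_cases i <;> rfl
  have hXslot : ∀ t₁ ybar i, (((X t₁ ybar i).1.2.1.1 : ℕ)) = 0 := fun t₁ ybar i => by fin_cases i <;> rfl
  have hXlegs : ∀ t₁ ybar, (fun i => ((((0 : Fin 1), (X t₁ ybar i).1.2.1.2), (X t₁ ybar i).1.2.2) : SectorLeg 1)) = Ω := fun t₁ ybar => by
    funext i; fin_cases i <;> rfl
  have hXpos : ∀ t₁ ybar, (fun i => (X t₁ ybar i).1.1) = ![of, (t₁, sf ybar)] := fun t₁ ybar => by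
    funext i; fin_cases i <;> rfl
  have hXres : ∀ t₁ ybar, (fun i => ((X t₁ ybar i).1.1.1, fun l => ((((X t₁ ybar i).1.1.2 l).val : ℕ) : ZMod L))) = ![oc, (t₁, sc ybar)] := by
    intro t₁ ybar; funext i; fin_cases i
    · rfl
    · simp only [hX1, Fin.mk_one, Matrix.cons_val_one]
      exact Prod.ext rfl (funext fun l => hres ybar l)
  -- the kernel of the doubled input difference at these strings (✓ D11a)
  have hker : ∀ t₁ ybar, kernel ℂ (klLipInputDiffD L b M β U μ K d k) 2 (X t₁ ybar) =
      (((imagTimeWeight β M : ℝ) : ℂ)) ^ 2 * WF t₁ ybar -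
        (if ∀ i, (klBlockEquivD L b M (d * k - 1) (X t₁ ybar i)).1 = (klBlockEquivD L b M (d * k - 1) (X t₁ ybar 0)).1 then
          (((imagTimeWeight β M : ℝ) : ℂ)) ^ 2 * WC t₁ ybar else 0) := by
    intro t₁ ybar
    rw [kernel_klLipInputDiffD_src β U μ K d k 2 0 (X t₁ ybar) (hXcopy t₁ ybar) (hXslot t₁ ybar), hXlegs, hXpos, hXres]
  -- the strings have source count 2, so the truncated difference has the same kernel there
  have hsrc : ∀ t₁ ybar, srcCount (fun Y : SrcLabel (b * L) M (d * k - 1) => Y.2 = 1) (X t₁ ybar) < 3 := by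
    intro t₁ ybar
    unfold srcCount
    exact lt_of_le_of_lt (card_le_univ _) (by simp)
  have hkerT : ∀ t₁ ybar, kernel ℂ (klLipInputDiffDT L b M β U μ K d k) 2 (X t₁ ybar) = kernel ℂ (klLipInputDiffD L b M β U μ K d k) 2 (X t₁ ybar) := by
    intro t₁ ybar; rw [kernel_klLipInputDiffDT, if_pos (hsrc t₁ ybar)]
  -- leaving the block is far
  have hfar : ∀ t₁ ybar, ¬ (∀ i, (klBlockEquivD L b M (d * k - 1) (X t₁ ybar i)).1 = (klBlockEquivD L b M (d * k - 1) (X t₁ ybar 0)).1) →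
      R < Torus.tnorm (sf ybar - of.2) := by
    intro t₁ ybar hnot
    push Not at hnot
    obtain ⟨i, hi⟩ := hnot
    fin_cases i
    · exact absurd rfl hi
    · have hi' : (klBlockEquivD L b M (d * k - 1) (X t₁ ybar 1)).1 ≠ (klBlockEquivD L b M (d * k - 1) (X t₁ ybar 0)).1 := hi
      rw [hX1, hX0, hw, klBlockEquivD_apply, klBlockEquivD_apply] at hi'
      dsimp only at hi'
      have hne : ∃ j, ((sf ybar) j).val / L ≠ (of.2 j).val / L := by
        by_contra hall
        push Not at hall
        apply hi'
        funext j
        apply Fin.ext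
        rw [klBlockEquiv_val, klBlockEquiv_val]
        exact hall j
      obtain ⟨j, hj⟩ := hne
      exact tnorm_sub_gt_of_block_ne (d := 2) (M := b * L) (m := L) (b := b) rfl hj (Or.inr hof)
  -- pointwise bound of the `T` part
  have hpt : ∀ t₁ ybar, ‖WC t₁ ybar - WF t₁ ybar‖ ≤
      (imagTimeWeight β M ^ 2)⁻¹ * ‖kernel ℂ (klLipInputDiffDT L b M β U μ K d k) 2 (X t₁ ybar)‖ +
        (if R < Torus.tnorm (sf ybar - of.2) then ‖WC t₁ ybar‖ + ‖WF t₁ ybar‖ else 0) := by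
    intro t₁ ybar
    have hk0 : 0 ≤ (imagTimeWeight β M ^ 2)⁻¹ * ‖kernel ℂ (klLipInputDiffDT L b M β U μ K d k) 2 (X t₁ ybar)‖ := by positivity
    by_cases hblk : ∀ i, (klBlockEquivD L b M (d * k - 1) (X t₁ ybar i)).1 = (klBlockEquivD L b M (d * k - 1) (X t₁ ybar 0)).1
    · have hk : ‖kernel ℂ (klLipInputDiffDT L b M β U μ K d k) 2 (X t₁ ybar)‖ = imagTimeWeight β M ^ 2 * ‖WC t₁ ybar - WF t₁ ybar‖ := by
        rw [hkerT, hker, if_pos hblk, ← mul_sub, norm_mul, norm_pow, Complex.norm_real, Real.norm_of_nonneg hx.le, norm_sub_rev]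
      rw [hk, ← mul_assoc, inv_mul_cancel₀ hx2.ne', one_mul]
      exact le_add_of_nonneg_right (by split_ifs <;> positivity)
    · rw [if_pos (hfar t₁ ybar hblk)]
      exact (norm_sub_le _ _).trans (le_add_of_nonneg_left hk0)
  -- the plain strings through `w` inject into the pinned family
  have hinj : Function.Injective (fun p : ImagTimeIdx M × TorusSite 2 L => X p.1 p.2) := by
    intro p q hpq
    have h1 : X p.1 p.2 1 = X q.1 q.2 1 := congrFun hpq 1
    rw [hX1, hX1] at h1
    have h11 : ((p.1, sf p.2) : SpaceTimeIdx (b * L) M) = (q.1, sf q.2) := congrArg (fun Y : SrcLabel (b * L) M (d * k - 1) => Y.1.1) h1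
    obtain ⟨ha, hb⟩ := Prod.mk.injEq _ _ _ _ ▸ h11
    exact Prod.ext ha (hsf hb)
  have hdeepw : w ∈ klDeepPinsD (V := b * L) (M := M) (n := d * k - 1) L R := mem_klDeepPinsD.2 (mem_klDeepPins.2 hof)
  have hsub : (univ : Finset (ImagTimeIdx M × TorusSite 2 L)).image (fun p => X p.1 p.2) ⊆
      univ.filter (fun Y : Fin 2 → SrcLabel (b * L) M (d * k - 1) => Y 0 = w) := by
    intro Y hY
    obtain ⟨p, -, rfl⟩ := Finset.mem_image.1 hY
    exact Finset.mem_filter.2 ⟨Finset.mem_univ _, hX0 p.1 p.2⟩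
  have hsumK : ∑ t₁ : ImagTimeIdx M, ∑ ybar : TorusSite 2 L, ‖kernel ℂ (klLipInputDiffDT L b M β U μ K d k) 2 (X t₁ ybar)‖ ≤
      klLipInputDiffSupDT L b M β U μ K d k 2 R := by
    calc ∑ t₁ : ImagTimeIdx M, ∑ ybar : TorusSite 2 L, ‖kernel ℂ (klLipInputDiffDT L b M β U μ K d k) 2 (X t₁ ybar)‖
        = ∑ p : ImagTimeIdx M × TorusSite 2 L, ‖kernel ℂ (klLipInputDiffDT L b M β U μ K d k) 2 (X p.1 p.2)‖ :=
          (Fintype.sum_prod_type' fun t₁ ybar => ‖kernel ℂ (klLipInputDiffDT L b M β U μ K d k) 2 (X t₁ ybar)‖).symm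
      _ = ∑ Y ∈ (univ : Finset (ImagTimeIdx M × TorusSite 2 L)).image (fun p => X p.1 p.2), ‖kernel ℂ (klLipInputDiffDT L b M β U μ K d k) 2 Y‖ := by
          rw [Finset.sum_image fun p _ q _ h => hinj h]
      _ ≤ ∑ Y ∈ univ.filter (fun Y : Fin 2 → SrcLabel (b * L) M (d * k - 1) => Y 0 = w), ‖kernel ℂ (klLipInputDiffDT L b M β U μ K d k) 2 Y‖ :=
          Finset.sum_le_sum_of_subset_of_nonneg hsub fun _ _ _ => norm_nonneg _
      _ ≤ klLipInputDiffSupDT L b M β U μ K d k 2 R := sum_le_klLipInputDiffSupDT β U μ K d k 2 R (0 : Fin 2) hdeepw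
  -- assemble
  have hsplit : ∀ t₁ ybar,
      ‖sectorisedKernel L M β (trivialMultiplier L M) (klTowerInput L M β U μ K d k - counterQuadratic L M β K) 2 Ω ![oc, (t₁, sc ybar)] -
          sectorisedKernel (b * L) M β (trivialMultiplier (b * L) M) (klTowerInput (b * L) M β U μ K d k - counterQuadratic (b * L) M β K) 2 Ω ![of, (t₁, sf ybar)]‖ ≤
        ‖WC t₁ ybar - WF t₁ ybar‖ + ‖NC t₁ ybar - NF t₁ ybar‖ := by
    intro t₁ ybar
    rw [sectorisedKernel_sub_apply, sectorisedKernel_sub_apply]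
    have : (WC t₁ ybar - NC t₁ ybar) - (WF t₁ ybar - NF t₁ ybar) = (WC t₁ ybar - WF t₁ ybar) - (NC t₁ ybar - NF t₁ ybar) := by ring
    simp only [hWC, hWF, hNC, hNF] at this ⊢
    rw [this]
    exact norm_sub_le _ _
  have hA : ∑ t₁ : ImagTimeIdx M, ∑ ybar : TorusSite 2 L, (imagTimeWeight β M ^ 2)⁻¹ * ‖kernel ℂ (klLipInputDiffDT L b M β U μ K d k) 2 (X t₁ ybar)‖ ≤
      (imagTimeWeight β M ^ 2)⁻¹ * klLipInputDiffSupDT L b M β U μ K d k 2 R := by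
    have heq : ∑ t₁ : ImagTimeIdx M, ∑ ybar : TorusSite 2 L, (imagTimeWeight β M ^ 2)⁻¹ * ‖kernel ℂ (klLipInputDiffDT L b M β U μ K d k) 2 (X t₁ ybar)‖ =
        (imagTimeWeight β M ^ 2)⁻¹ * ∑ t₁ : ImagTimeIdx M, ∑ ybar : TorusSite 2 L, ‖kernel ℂ (klLipInputDiffDT L b M β U μ K d k) 2 (X t₁ ybar)‖ := by
      rw [Finset.mul_sum]
      exact Finset.sum_congr rfl fun t₁ _ => (Finset.mul_sum _ _ _).symm
    rw [heq]
    exact mul_le_mul_of_nonneg_left hsumK (inv_nonneg.2 hx2.le)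
  have hB : ∑ t₁ : ImagTimeIdx M, ∑ ybar : TorusSite 2 L, (if R < Torus.tnorm (sf ybar - of.2) then ‖WC t₁ ybar‖ + ‖WF t₁ ybar‖ else 0) ≤ Far := by
    have heq : ∑ t₁ : ImagTimeIdx M, ∑ ybar : TorusSite 2 L, (if R < Torus.tnorm (sf ybar - of.2) then ‖WC t₁ ybar‖ + ‖WF t₁ ybar‖ else 0) =
        ∑ t₁ : ImagTimeIdx M, ∑ ybar ∈ univ.filter (fun ybar : TorusSite 2 L => R < Torus.tnorm (sf ybar - of.2)), (‖WC t₁ ybar‖ + ‖WF t₁ ybar‖) :=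
      Finset.sum_congr rfl fun t₁ _ => (Finset.sum_filter _ _).symm
    rw [heq]
    simpa only [hWC, hWF] using hFar
  have hC : ∑ t₁ : ImagTimeIdx M, ∑ ybar : TorusSite 2 L, ‖NC t₁ ybar - NF t₁ ybar‖ ≤ Seam := by simpa only [hNC, hNF] using hSeam
  calc _ ≤ ∑ t₁ : ImagTimeIdx M, ∑ ybar : TorusSite 2 L, (‖WC t₁ ybar - WF t₁ ybar‖ + ‖NC t₁ ybar - NF t₁ ybar‖) :=
        sum_le_sum fun t₁ _ => sum_le_sum fun ybar _ => hsplit t₁ ybar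
    _ ≤ ∑ t₁ : ImagTimeIdx M, ∑ ybar : TorusSite 2 L,
          (((imagTimeWeight β M ^ 2)⁻¹ * ‖kernel ℂ (klLipInputDiffDT L b M β U μ K d k) 2 (X t₁ ybar)‖ +
            (if R < Torus.tnorm (sf ybar - of.2) then ‖WC t₁ ybar‖ + ‖WF t₁ ybar‖ else 0)) + ‖NC t₁ ybar - NF t₁ ybar‖) :=
        sum_le_sum fun t₁ _ => sum_le_sum fun ybar _ => add_le_add (hpt t₁ ybar) le_rfl
    _ = ∑ t₁ : ImagTimeIdx M, ∑ ybar : TorusSite 2 L, (imagTimeWeight β M ^ 2)⁻¹ * ‖kernel ℂ (klLipInputDiffDT L b M β U μ K d k) 2 (X t₁ ybar)‖ +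
          ∑ t₁ : ImagTimeIdx M, ∑ ybar : TorusSite 2 L, (if R < Torus.tnorm (sf ybar - of.2) then ‖WC t₁ ybar‖ + ‖WF t₁ ybar‖ else 0) +
          ∑ t₁ : ImagTimeIdx M, ∑ ybar : TorusSite 2 L, ‖NC t₁ ybar - NF t₁ ybar‖ := by
        simp only [sum_add_distrib]
    _ ≤ (imagTimeWeight β M ^ 2)⁻¹ * klLipInputDiffSupDT L b M β U μ K d k 2 R + Far + Seam := by linarith [hA, hB, hC]

/-- **F-D1's `hPc σ` FROM THE TRUNCATED DOUBLED TOWER** (both orientations of ✓ `hPd_of_commonFrame_add_conversion`'s common-frame defect, at a fine pin `of` that is `R`-deep in its coarse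
block and `oc := res of`): `≤ 2ε⁻²·klLipInputDiffSupDT … d k 2 R + (Far₊ + Far₋) + (Seam₊ + Seam₋)` — the degree-2 input-difference sup of block `k` of the truncated doubled tower (the
second conclusion of the assembly `klLipBornDiffSupDT_le_law_of_rows_base1_boot`), the coarse/fine raw far two-leg rows over the offsets leaving the block, and the counterterm seam.
[cite: BenfattoGiulianiMastropietro2006, §2.9 (4.3)-(4.8)] -/
theorem hPc_of_truncReadout {β : ℝ} (hβ : 0 < β) (U μ : ℝ) (K : TrigPolyC4v) (d k R : ℕ) (σ : Fin 2)
    (of : SpaceTimeIdx (b * L) M) (hof : ∀ j, R ≤ (of.2 j).val % L ∧ (of.2 j).val % L + R < L) {FarP FarM SeamP SeamM : ℝ}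
    (hFarP : ∑ t₁ : ImagTimeIdx M, ∑ ybar ∈ univ.filter (fun ybar : TorusSite 2 L => R < Torus.tnorm (Torus.proj (b * L) (Torus.cRep ybar))),
        (‖sectorisedKernel L M β (trivialMultiplier L M) (klTowerInput L M β U μ K d k) 2
              (![((0, σ), 0), ((0, σ), 1)] : Fin 2 → SectorLeg 1)
              ![(of.1, fun i => (((of.2 i).val : ℕ) : ZMod L)), (t₁, (fun i => (((of.2 i).val : ℕ) : ZMod L)) + ybar)]‖ +
          ‖sectorisedKernel (b * L) M β (trivialMultiplier (b * L) M) (klTowerInput (b * L) M β U μ K d k) 2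
              (![((0, σ), 0), ((0, σ), 1)] : Fin 2 → SectorLeg 1) ![of, (t₁, of.2 + Torus.proj (b * L) (Torus.cRep ybar))]‖) ≤ FarP)
    (hFarM : ∑ t₁ : ImagTimeIdx M, ∑ ybar ∈ univ.filter (fun ybar : TorusSite 2 L => R < Torus.tnorm (Torus.proj (b * L) (Torus.cRep ybar))),
        (‖sectorisedKernel L M β (trivialMultiplier L M) (klTowerInput L M β U μ K d k) 2
              (![((0, σ), 0), ((0, σ), 1)] : Fin 2 → SectorLeg 1)
              ![(of.1, fun i => (((of.2 i).val : ℕ) : ZMod L)), (t₁, (fun i => (((of.2 i).val : ℕ) : ZMod L)) + -ybar)]‖ +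
          ‖sectorisedKernel (b * L) M β (trivialMultiplier (b * L) M) (klTowerInput (b * L) M β U μ K d k) 2
              (![((0, σ), 0), ((0, σ), 1)] : Fin 2 → SectorLeg 1) ![of, (t₁, of.2 + -Torus.proj (b * L) (Torus.cRep ybar))]‖) ≤ FarM)
    (hSeamP : ∑ t₁ : ImagTimeIdx M, ∑ ybar : TorusSite 2 L,
        ‖sectorisedKernel L M β (trivialMultiplier L M) (counterQuadratic L M β K) 2
              (![((0, σ), 0), ((0, σ), 1)] : Fin 2 → SectorLeg 1)
              ![(of.1, fun i => (((of.2 i).val : ℕ) : ZMod L)), (t₁, (fun i => (((of.2 i).val : ℕ) : ZMod L)) + ybar)] -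
            sectorisedKernel (b * L) M β (trivialMultiplier (b * L) M) (counterQuadratic (b * L) M β K) 2
              (![((0, σ), 0), ((0, σ), 1)] : Fin 2 → SectorLeg 1) ![of, (t₁, of.2 + Torus.proj (b * L) (Torus.cRep ybar))]‖ ≤ SeamP)
    (hSeamM : ∑ t₁ : ImagTimeIdx M, ∑ ybar : TorusSite 2 L,
        ‖sectorisedKernel L M β (trivialMultiplier L M) (counterQuadratic L M β K) 2
              (![((0, σ), 0), ((0, σ), 1)] : Fin 2 → SectorLeg 1)
              ![(of.1, fun i => (((of.2 i).val : ℕ) : ZMod L)), (t₁, (fun i => (((of.2 i).val : ℕ) : ZMod L)) + -ybar)] -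
            sectorisedKernel (b * L) M β (trivialMultiplier (b * L) M) (counterQuadratic (b * L) M β K) 2
              (![((0, σ), 0), ((0, σ), 1)] : Fin 2 → SectorLeg 1) ![of, (t₁, of.2 + -Torus.proj (b * L) (Torus.cRep ybar))]‖ ≤ SeamM) :
    ∑ t₁ : ImagTimeIdx M, ∑ ybar : TorusSite 2 L,
        (‖sectorisedKernel L M β (trivialMultiplier L M) (klTowerInput L M β U μ K d k - counterQuadratic L M β K) 2
              (![((0, σ), 0), ((0, σ), 1)] : Fin 2 → SectorLeg 1)
              ![(of.1, fun i => (((of.2 i).val : ℕ) : ZMod L)), (t₁, (fun i => (((of.2 i).val : ℕ) : ZMod L)) + ybar)] -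
            sectorisedKernel (b * L) M β (trivialMultiplier (b * L) M) (klTowerInput (b * L) M β U μ K d k - counterQuadratic (b * L) M β K) 2
              (![((0, σ), 0), ((0, σ), 1)] : Fin 2 → SectorLeg 1) ![of, (t₁, of.2 + Torus.proj (b * L) (Torus.cRep ybar))]‖ +
          ‖sectorisedKernel L M β (trivialMultiplier L M) (klTowerInput L M β U μ K d k - counterQuadratic L M β K) 2
              (![((0, σ), 0), ((0, σ), 1)] : Fin 2 → SectorLeg 1)
              ![(of.1, fun i => (((of.2 i).val : ℕ) : ZMod L)), (t₁, (fun i => (((of.2 i).val : ℕ) : ZMod L)) + -ybar)] -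
            sectorisedKernel (b * L) M β (trivialMultiplier (b * L) M) (klTowerInput (b * L) M β U μ K d k - counterQuadratic (b * L) M β K) 2
              (![((0, σ), 0), ((0, σ), 1)] : Fin 2 → SectorLeg 1) ![of, (t₁, of.2 + -Torus.proj (b * L) (Torus.cRep ybar))]‖) ≤
      2 * ((imagTimeWeight β M ^ 2)⁻¹ * klLipInputDiffSupDT L b M β U μ K d k 2 R) + (FarP + FarM) + (SeamP + SeamM) := by
  classical
  -- injectivity of the two lifted second sites (their residues are `res of ± ȳ`)
  have hinjP : Function.Injective (fun ybar : TorusSite 2 L => of.2 + Torus.proj (b * L) (Torus.cRep ybar)) := by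
    intro y₁ y₂ h
    have h' : of.2 + Torus.proj (b * L) (Torus.cRep y₁) = of.2 + Torus.proj (b * L) (Torus.cRep y₂) := h
    funext i
    have h1 := (res_add_lift (L := L) (b := b) of.2 y₁ i).1
    have h2 := (res_add_lift (L := L) (b := b) of.2 y₂ i).1
    rw [h'] at h1
    exact add_left_cancel (h1.symm.trans h2)
  have hinjM : Function.Injective (fun ybar : TorusSite 2 L => of.2 + -Torus.proj (b * L) (Torus.cRep ybar)) := by
    intro y₁ y₂ h
    have h' : of.2 + -Torus.proj (b * L) (Torus.cRep y₁) = of.2 + -Torus.proj (b * L) (Torus.cRep y₂) := h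
    funext i
    have h1 := (res_add_lift (L := L) (b := b) of.2 y₁ i).2
    have h2 := (res_add_lift (L := L) (b := b) of.2 y₂ i).2
    rw [h'] at h1
    exact sub_right_injective (h1.symm.trans h2)
  -- the far filters: `(of.2 + ι ȳ) − of.2 = ι ȳ`, `(of.2 − ι ȳ) − of.2 = −ι ȳ` with `tnorm (−u) ≤ tnorm u`
  have hfiltP : (univ.filter fun ybar : TorusSite 2 L => R < Torus.tnorm ((of.2 + Torus.proj (b * L) (Torus.cRep ybar)) - of.2)) =
      univ.filter fun ybar : TorusSite 2 L => R < Torus.tnorm (Torus.proj (b * L) (Torus.cRep ybar)) := by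
    refine Finset.filter_congr fun ybar _ => ?_
    rw [add_sub_cancel_left]
  have hsubM : (univ.filter fun ybar : TorusSite 2 L => R < Torus.tnorm ((of.2 + -Torus.proj (b * L) (Torus.cRep ybar)) - of.2)) ⊆
      univ.filter fun ybar : TorusSite 2 L => R < Torus.tnorm (Torus.proj (b * L) (Torus.cRep ybar)) := by
    intro ybar h
    rw [Finset.mem_filter] at h ⊢
    refine ⟨h.1, lt_of_lt_of_le h.2 ?_⟩
    rw [add_sub_cancel_left]
    exact Torus.tnorm_neg_le _
  have hFarP' := hFarP
  rw [← hfiltP] at hFarP'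
  have hFarM' : ∑ t₁ : ImagTimeIdx M, ∑ ybar ∈ univ.filter (fun ybar : TorusSite 2 L => R < Torus.tnorm ((of.2 + -Torus.proj (b * L) (Torus.cRep ybar)) - of.2)),
      (‖sectorisedKernel L M β (trivialMultiplier L M) (klTowerInput L M β U μ K d k) 2
            (![((0, σ), 0), ((0, σ), 1)] : Fin 2 → SectorLeg 1)
            ![(of.1, fun i => (((of.2 i).val : ℕ) : ZMod L)), (t₁, (fun i => (((of.2 i).val : ℕ) : ZMod L)) + -ybar)]‖ +
        ‖sectorisedKernel (b * L) M β (trivialMultiplier (b * L) M) (klTowerInput (b * L) M β U μ K d k) 2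
            (![((0, σ), 0), ((0, σ), 1)] : Fin 2 → SectorLeg 1) ![of, (t₁, of.2 + -Torus.proj (b * L) (Torus.cRep ybar))]‖) ≤ FarM :=
    (sum_le_sum fun t₁ _ => Finset.sum_le_sum_of_subset_of_nonneg hsubM fun _ _ _ => by positivity).trans hFarM
  have hP := plainTwoLegDefect_le (L := L) (b := b) (M := M) hβ U μ K d k R σ of hof
    (fun ybar => (fun i => (((of.2 i).val : ℕ) : ZMod L)) + ybar) (fun ybar => of.2 + Torus.proj (b * L) (Torus.cRep ybar)) hinjP
    (fun ybar i => (res_add_lift (L := L) (b := b) of.2 ybar i).1) hFarP' hSeamP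
  have hM := plainTwoLegDefect_le (L := L) (b := b) (M := M) hβ U μ K d k R σ of hof
    (fun ybar => (fun i => (((of.2 i).val : ℕ) : ZMod L)) + -ybar) (fun ybar => of.2 + -Torus.proj (b * L) (Torus.cRep ybar)) hinjM
    (fun ybar i => by have h := (res_add_lift (L := L) (b := b) of.2 ybar i).2; rw [sub_eq_add_neg] at h; exact h) hFarM' hSeamM
  simp only [sum_add_distrib]
  linarith

end ReadoutDT

end Summit.HubbardSuperconductivity.HubbardSuperconductivity.Theorems.TwoVolumeLip

end
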